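import Literature.NumberTheory.NumberFields.SelmerGroupPID
import HarnessLib

/-!
# `K(S, n)` for a class-number-one number field: `n`-th powers

Topic `NumberTheory/NumberFields`. The `n`-th power analogue of the tree's
`Literature/NumberTheory/NumberFields/SelmerGroupPID.lean` (`n = 2`): for a number field `K` whose
ring of integers is a principal ideal domain, the group
`K(S, n) = {b ∈ Kˣ/Kˣⁿ : ord_v(b) ≡ 0 (mod n) for all v ∉ S}` (Silverman, *AEC*, proof of
Prop. VIII.1.6 and Thm. X.1.1(c); for the `φ`-descent via a `3`-isogeny, `n = 3`, Prop. X.4.9 and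
Exercise 10.9) is spanned by the units and the prime elements above `S`:

* `exists_eq_unit_mul_prod_pow_mul_pow_int`: `𝓞 K` a PID, `D ∈ 𝓞 K`, `G : ι → 𝓞 K` a finite
  family such that every prime element dividing `D` is associated to some `G i` (the primes above
  `S = {v : D ∈ v}`), `0 < n`: every non-zero `a ∈ 𝓞 K` with `n ∣ ord_v(a)` for all finite
  places `v ∌ D` is `a = u · ∏ᵢ (G i)^{eᵢ} · wⁿ` for a unit `u`, exponents `eᵢ` and `w ∈ 𝓞 K`
  (induction on the ideal norm, peeling prime factors: a prime `q ∤ D` occurs to an `n`-th power,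
  `IsDedekindDomain.HeightOneSpectrum.intValuation_le_pow_iff_mem`; a prime `q ∣ D` is a unit times
  some `G i`);
* `exists_eq_unit_mul_prod_pow_mul_pow`: the same for `b ∈ Kˣ` (clear denominators:
  `b · yⁿ = x · yⁿ⁻¹`), with the exponents reduced modulo `n` (`eᵢ < n`) and `w ∈ Kˣ`.

For `n = 3` and `K = ℚ(ζ₃)` (`h = 1`, units `±ζ₃^k`, cubes `−1 = (−1)³`) this makes
`K(S, 3) = ⟨ζ₃, 1 − ζ₃, 2, 5⟩` (`S` the places above `30`) explicit for the `√−3`-descent on the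
cubic twists `y² = x³ + (2^a 5^b)²`
(`Literature/Barriers/BirchSwinnertonDyer/RankNotSumOfLocalInvariantsCubicTwists.lean`). Theorems
only, topic namespace `Literature.NumberTheory.NumberFields`.

## References

* J. H. Silverman, *The Arithmetic of Elliptic Curves*, 2nd ed., GTM 106 (2009), Prop. VIII.1.6
  (proof), Thm. X.1.1(c), Prop. X.4.9. [SilvermanAEC2009]
-/

noncomputable section

open scoped NumberField
open IsDedekindDomain IsDedekindDomain.HeightOneSpectrum Ideal

namespace Literature.NumberTheory.NumberFields

variable {K : Type*} [Field K] [NumberField K]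

/-- `q ∣ a`, `0 < n` and `n ∣ ord_{(q)}(a)` give `qⁿ ∣ a` (`a ≠ 0`): the valuation is `exp(-m)`
with `m ≥ 1` a multiple of `n`, so `m ≥ n`. [folklore] -/
theorem pow_dvd_of_prime_dvd_of_dvd_log {q a : 𝓞 K} (hq : Prime q) (ha : a ≠ 0)
    (hqa : q ∣ a) {n : ℕ} (hn : 0 < n)
    (hdvd : (n : ℤ) ∣ WithZero.log ((placeOfPrime hq).valuation K (a : K))) : q ^ n ∣ a := by
  set v := placeOfPrime hq with hv
  rw [valuation_of_algebraMap] at hdvd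
  have hlt : v.intValuation a < 1 := (intValuation_lt_one_iff_dvd v a).mpr (by
    rw [hv, placeOfPrime, dvd_span_singleton]; exact mem_span_singleton.mpr hqa)
  have hne : v.intValuation a ≠ 0 := intValuation_ne_zero v a ha
  set m := WithZero.log (v.intValuation a) with hm
  have hexp : v.intValuation a = WithZero.exp m := (WithZero.exp_log hne).symm
  have hm0 : m < 0 := by
    have : WithZero.exp m < WithZero.exp 0 := by rw [← hexp, WithZero.exp_zero]; exact hlt
    exact WithZero.exp_lt_exp.mp this
  obtain ⟨k, hk⟩ := hdvd
  have hk' : k ≤ -1 := by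
    by_contra h
    have h0 : 0 ≤ (n : ℤ) * k := mul_nonneg (by positivity) (by omega)
    omega
  have hle : v.intValuation a ≤ WithZero.exp (-(n : ℕ) : ℤ) := by
    rw [hexp, WithZero.exp_le_exp]
    nlinarith
  have hmem := (intValuation_le_pow_iff_mem v a n).mp hle
  rw [hv, placeOfPrime] at hmem
  change a ∈ span {q} ^ n at hmem
  rw [span_singleton_pow, mem_span_singleton] at hmem
  exact hmem

/-- `n ∣ ord_v(x y) ↔ n ∣ ord_v(x)` when `n ∣ ord_v(y)` (`x, y ≠ 0`; `log` is additive).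
[folklore] -/
theorem dvd_log_valuation_mul_iff (v : HeightOneSpectrum (𝓞 K)) (n : ℤ) {x y : K} (hx : x ≠ 0)
    (hy : y ≠ 0) (h : n ∣ WithZero.log (v.valuation K y)) :
    n ∣ WithZero.log (v.valuation K (x * y)) ↔ n ∣ WithZero.log (v.valuation K x) := by
  rw [map_mul, WithZero.log_mul ((v.valuation K).ne_zero_iff.mpr hx)
    ((v.valuation K).ne_zero_iff.mpr hy)]
  exact ⟨fun h' => (Int.dvd_add_left h).mp h', fun h' => dvd_add h' h⟩

/-- `n ∣ ord_v(yⁿ)`. [folklore] -/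
theorem dvd_log_valuation_pow (v : HeightOneSpectrum (𝓞 K)) (n : ℕ) (y : K) :
    (n : ℤ) ∣ WithZero.log (v.valuation K (y ^ n)) := by
  rw [map_pow, WithZero.log_pow, nsmul_eq_mul]
  exact Dvd.intro _ rfl

/-- **The integral case.** `𝓞 K` a PID, `D ∈ 𝓞 K`, `G : ι → 𝓞 K` a finite family such that every
prime element dividing `D` is associated to some `G i` (the prime elements above `S`), `0 < n`:
every non-zero `a ∈ 𝓞 K` with `n ∣ ord_v(a)` for all `v ∌ D` is a unit times a monomial in the
`G i` times an `n`-th power. (Induction on the ideal norm.)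
[cite: SilvermanAEC2009, Prop. VIII.1.6 (proof)] -/
theorem exists_eq_unit_mul_prod_pow_mul_pow_int [IsPrincipalIdealRing (𝓞 K)]
    {ι : Type*} [Fintype ι] [DecidableEq ι] (D : 𝓞 K) (G : ι → 𝓞 K)
    (hD : ∀ q : 𝓞 K, Prime q → q ∣ D → ∃ i, Associated q (G i)) {n : ℕ} (hn : 0 < n) :
    ∀ (a : 𝓞 K), a ≠ 0 →
      (∀ v : HeightOneSpectrum (𝓞 K), D ∉ v.asIdeal →
        (n : ℤ) ∣ WithZero.log (v.valuation K (a : K))) →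
      ∃ (u : (𝓞 K)ˣ) (e : ι → ℕ) (w : 𝓞 K), a = u * (∏ i, G i ^ e i) * w ^ n := by
  -- with a multiset of indices instead of exponents, by strong induction on the ideal norm
  suffices key : ∀ (N : ℕ) (a : 𝓞 K), absNorm (span {a}) = N → a ≠ 0 →
      (∀ v : HeightOneSpectrum (𝓞 K), D ∉ v.asIdeal →
        (n : ℤ) ∣ WithZero.log (v.valuation K (a : K))) →
      ∃ (u : (𝓞 K)ˣ) (s : Multiset ι) (w : 𝓞 K), a = u * (s.map G).prod * w ^ n by
    intro a ha hval
    obtain ⟨u, s, w, h⟩ := key _ a rfl ha hval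
    refine ⟨u, fun i ↦ s.count i, w, ?_⟩
    rw [h, Finset.prod_multiset_map_count]
    congr 2
    exact Finset.prod_subset (Finset.subset_univ _) fun i _ hi ↦ by
      rw [Multiset.mem_toFinset] at hi
      rw [Multiset.count_eq_zero_of_notMem hi, pow_zero]
  intro N
  induction N using Nat.strong_induction_on with
  | _ N ih =>
  classical
  intro a haN ha hval
  by_cases hu : IsUnit a
  · exact ⟨hu.unit, 0, 1, by simp⟩
  · obtain ⟨q, hqirr, hqa⟩ := WfDvdMonoid.exists_irreducible_factor hu ha
    have hq : Prime q := UniqueFactorizationMonoid.irreducible_iff_prime.mp hqirr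
    have hq0 : q ≠ 0 := hq.ne_zero
    have hnormq : 1 < absNorm (span {q}) := by
      rcases Nat.lt_or_ge 1 (absNorm (span {q})) with h | h
      · exact h
      · exfalso
        interval_cases h' : absNorm (span ({q} : Set (𝓞 K)))
        · exact hq0 (span_singleton_eq_bot.mp (absNorm_eq_zero_iff.mp h'))
        · exact hq.not_unit (span_singleton_eq_top.mp (absNorm_eq_one_iff.mp h'))
    by_cases hqD : q ∣ D
    · -- `q ∣ D`: `q ~ G i`, `a = G i * a₁`
      obtain ⟨i, hqg⟩ := hD q hq hqD
      have hga : G i ∣ a := hqg.symm.dvd.trans hqa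
      obtain ⟨a₁, rfl⟩ := hga
      have ha₁ : a₁ ≠ 0 := right_ne_zero_of_mul ha
      have hg0 : G i ≠ 0 := left_ne_zero_of_mul ha
      have hgD : G i ∣ D := hqg.symm.dvd.trans hqD
      have hlt : absNorm (span {a₁}) < N := by
        rw [← haN, ← span_singleton_mul_span_singleton, map_mul]
        have h1 : 1 < absNorm (span {G i}) := by
          rw [span_singleton_eq_span_singleton.mpr hqg.symm]; exact hnormq
        have h2 : 0 < absNorm (span {a₁}) := Nat.pos_of_ne_zero fun h =>
          ha₁ (span_singleton_eq_bot.mp (absNorm_eq_zero_iff.mp h))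
        nlinarith
      have hval₁ : ∀ v : HeightOneSpectrum (𝓞 K), D ∉ v.asIdeal →
          (n : ℤ) ∣ WithZero.log (v.valuation K (a₁ : K)) := by
        intro v hv
        have hgv : G i ∉ v.asIdeal := fun h => hv (Ideal.mem_of_dvd _ hgD |> fun f => f h)
        have h := hval v hv
        push_cast at h
        rw [mul_comm] at h
        exact (dvd_log_valuation_mul_iff v n (by exact_mod_cast ha₁) (by exact_mod_cast hg0)
          (by rw [log_valuation_eq_zero_of_not_mem v hgv]; exact dvd_zero _)).mp h
      obtain ⟨u, s, w, h⟩ := ih _ hlt a₁ rfl ha₁ hval₁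
      refine ⟨u, i ::ₘ s, w, ?_⟩
      rw [Multiset.map_cons, Multiset.prod_cons, h]
      ring
    · -- `q ∤ D`: `qⁿ ∣ a`
      set v := placeOfPrime hq with hvdef
      have hDv : D ∉ v.asIdeal := by
        change D ∉ span {q}
        rw [mem_span_singleton]; exact hqD
      have hqn : q ^ n ∣ a := pow_dvd_of_prime_dvd_of_dvd_log hq ha hqa hn (hval v hDv)
      obtain ⟨a₁, rfl⟩ := hqn
      have ha₁ : a₁ ≠ 0 := right_ne_zero_of_mul ha
      have hlt : absNorm (span {a₁}) < N := by
        rw [← haN, ← span_singleton_mul_span_singleton, map_mul, ← span_singleton_pow, map_pow]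
        have h2 : 0 < absNorm (span {a₁}) := Nat.pos_of_ne_zero fun h =>
          ha₁ (span_singleton_eq_bot.mp (absNorm_eq_zero_iff.mp h))
        have h3 : 1 < absNorm (span {q}) ^ n := Nat.one_lt_pow hn.ne' hnormq
        calc absNorm (span {a₁}) = 1 * absNorm (span {a₁}) := (one_mul _).symm
          _ < absNorm (span {q}) ^ n * absNorm (span {a₁}) := Nat.mul_lt_mul_of_pos_right h3 h2
      have hval₁ : ∀ v : HeightOneSpectrum (𝓞 K), D ∉ v.asIdeal →
          (n : ℤ) ∣ WithZero.log (v.valuation K (a₁ : K)) := by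
        intro v' hv'
        have h := hval v' hv'
        push_cast at h
        rw [mul_comm] at h
        have hq0' : ((q : K) ^ n) ≠ 0 := pow_ne_zero n (by exact_mod_cast hq0)
        exact (dvd_log_valuation_mul_iff v' n (by exact_mod_cast ha₁) hq0'
          (dvd_log_valuation_pow v' n _)).mp h
      obtain ⟨u, s, w, h⟩ := ih _ hlt a₁ rfl ha₁ hval₁
      refine ⟨u, s, q * w, ?_⟩
      rw [h]
      ring

/-- Reducing the exponents of a monomial modulo `n`: `∏ gᵢ^{eᵢ} = ∏ gᵢ^{eᵢ mod n} · (∏ gᵢ^{eᵢ / n})ⁿ`.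
[folklore] -/
theorem prod_pow_eq_prod_pow_mod_mul_pow {M : Type*} [CommMonoid M] {ι : Type*} (s : Finset ι)
    (g : ι → M) (e : ι → ℕ) (n : ℕ) :
    ∏ i ∈ s, g i ^ e i = (∏ i ∈ s, g i ^ (e i % n)) * (∏ i ∈ s, g i ^ (e i / n)) ^ n := by
  rw [← Finset.prod_pow, ← Finset.prod_mul_distrib]
  refine Finset.prod_congr rfl fun i _ ↦ ?_
  rw [← pow_mul, ← pow_add, Nat.mod_add_div']

/-- **`K(S, n)` is spanned by units and the primes above `S` when `h_K = 1`.** Let `𝓞 K` be a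
PID, `D ∈ 𝓞 K`, `G : ι → 𝓞 K` a finite family (of prime elements, in practice) such that every
prime element dividing `D` is associated to some `G i`, and `0 < n`. If `b ∈ Kˣ` has
`ord_v(b) ≡ 0 (mod n)` for every finite place `v` with `D ∉ v` (i.e. `b̄ ∈ K(S, n)` for `S` the
places dividing `D`), then `b = u · ∏ᵢ (G i)^{eᵢ} · wⁿ` for some unit `u ∈ (𝓞 K)ˣ`, exponents
`0 ≤ eᵢ < n` and `w ∈ Kˣ`. (Silverman, proof of Prop. VIII.1.6: "`R_S` is a principal ideal
domain … every `b` representing an element of `T_S` … is an `S`-unit times an `m`-th power", here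
for `h_K = 1` without enlarging `S`; for `n = 3` the group `K(S, 3)` of the `φ`-descent,
Prop. X.4.9.) [cite: SilvermanAEC2009, Prop. VIII.1.6 (proof)] -/
theorem exists_eq_unit_mul_prod_pow_mul_pow [IsPrincipalIdealRing (𝓞 K)]
    {ι : Type*} [Fintype ι] [DecidableEq ι] (D : 𝓞 K) (G : ι → 𝓞 K)
    (hD : ∀ q : 𝓞 K, Prime q → q ∣ D → ∃ i, Associated q (G i)) {n : ℕ} (hn : 0 < n)
    {b : K} (hb : b ≠ 0)
    (hval : ∀ v : HeightOneSpectrum (𝓞 K), D ∉ v.asIdeal →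
      (n : ℤ) ∣ WithZero.log (v.valuation K b)) :
    ∃ (u : (𝓞 K)ˣ) (e : ι → ℕ) (w : K), (∀ i, e i < n) ∧ w ≠ 0 ∧
      b = (u : 𝓞 K) * (∏ i, (G i : K) ^ e i) * w ^ n := by
  obtain ⟨x, y, hy, hxy⟩ := IsFractionRing.div_surjective (A := 𝓞 K) b
  have hy0 : y ≠ 0 := nonZeroDivisors.ne_zero hy
  have hy0' : (y : K) ≠ 0 := by exact_mod_cast hy0
  have hx0 : x ≠ 0 := by
    rintro rfl
    rw [map_zero, zero_div] at hxy
    exact hb hxy.symm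
  obtain ⟨m, hm⟩ : ∃ m, n = m + 1 := ⟨n - 1, by omega⟩
  -- `a = x yⁿ⁻¹`, `(a : K) = b yⁿ`
  have ha : ((x * y ^ m : 𝓞 K) : K) = b * (y : K) ^ n := by
    rw [← hxy, hm]; push_cast; field_simp; ring
  have hval' : ∀ v : HeightOneSpectrum (𝓞 K), D ∉ v.asIdeal →
      (n : ℤ) ∣ WithZero.log (v.valuation K ((x * y ^ m : 𝓞 K) : K)) := by
    intro v hv
    rw [ha]
    exact (dvd_log_valuation_mul_iff v n hb (pow_ne_zero n hy0')
      (dvd_log_valuation_pow v n _)).mpr (hval v hv)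
  obtain ⟨u, e, w, h⟩ := exists_eq_unit_mul_prod_pow_mul_pow_int D G hD hn (x * y ^ m)
    (mul_ne_zero hx0 (pow_ne_zero m hy0)) hval'
  -- reduce the exponents modulo `n` and divide by `y`
  set w' : K := (∏ i, (G i : K) ^ (e i / n)) * w / y with hw'
  have heq : b = (u : 𝓞 K) * (∏ i, (G i : K) ^ (e i % n)) * w' ^ n := by
    have hK : ((x * y ^ m : 𝓞 K) : K) = ((u * (∏ i, G i ^ e i) * w ^ n : 𝓞 K) : K) :=
      congrArg (fun z : 𝓞 K ↦ (z : K)) h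
    rw [ha] at hK
    push_cast at hK
    rw [prod_pow_eq_prod_pow_mod_mul_pow Finset.univ (fun i ↦ (G i : K)) e n] at hK
    rw [hw', div_pow, mul_pow, ← mul_div_assoc, eq_div_iff (pow_ne_zero n hy0')]
    linear_combination hK
  refine ⟨u, fun i ↦ e i % n, w', fun i ↦ Nat.mod_lt _ hn, ?_, heq⟩
  rintro hw0
  rw [hw0, zero_pow hn.ne', mul_zero] at heq
  exact hb heq

end Literature.NumberTheory.NumberFields
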